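import Summits.AtomisticToContinuum.BoseEinsteinCondensation.Theorems.BECGroundStateSOSPeriodicIRBoundTwoSectorPairDefs
import Summits.AtomisticToContinuum.BoseEinsteinCondensation.Theorems.BECGroundStateSOSPeriodicIRBoundTwoSectorKLST
import HarnessLib

/-!
# Route `BECGroundStateSOS`, crux `PeriodicIRBound` (stmt-AtomisticToContinuum-3972), line `two-sector-gd-transfer` (v11) —
# stub S11b `stub_fsumLowerBound : FsumLowerBound` (the two-sided f-sum at near-minimisers with the exchange term kept)

Supports (does not close) stmt-AtomisticToContinuum-3972. The registered stub S11b of the v11 ("pointwise floating + soft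
location") skeleton `Cruxes/PeriodicIRBound/Lines/two_sector_gd_transfer.lean` (statement `FsumLowerBound` in
`Theorems/BECGroundStateSOSPeriodicIRBoundTwoSectorPairDefs.lean` §2, SOFT-LOCATION.md Step 2): for an integrable admissible
`v`, fixed `(N, L) = (m+2, L)` with finite `E₀(N)` and a mode `n ≠ 0`, for every `η > 0` there is a slack `δ > 0` such that
every `δ`-near-minimiser `Ψ` of `H_N` (any momentum) obeys, with `ψ = Ψ.ψ`, `n_k = n_ψ(φ_n)`, `p = 2πn/L` and the exchange
coefficient `E_ψ = WF.exchCoef v L n ψ`,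
`𝓔[a(φ_n)ψ] + 𝓔[a†(φ_n)ψ] − E₀(N)(2n_k + 1) ≥ ‖p‖² + N‖v‖₁/L³ + N·Re E_ψ − η`.

Proof. (1) The two-sided f-sum IDENTITY `FsumLower.toReal_qform_modeAn_add_modeCr` — the identity behind the landed one-sided
Wagner–Feynman form inequality `WF.wagnerFeynman_form_le` (where the exchange term is thrown away by `WF.abs_exchCoef_re_le`):
the kinetic identity `WF.kinetic_wagnerFeynman` (`T[aψ] + T[a†ψ] = ‖p‖²‖ψ‖² + T[ψ] + 2Re B_0(ψ, N̂ψ)`, `WF.formRe_zero_numOp`,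
`N̂ = a†a`), the potential identity `WF.potForm_modeCr` (`P[a†ψ] = P[ψ] + N‖v‖₁/L³‖ψ‖² + P[aψ] + 2N∑_b Re s_b + N Re E_ψ`) and
the cross term `WF.potRe_numOp` (`potRe_v(ψ, N̂ψ) = P[aψ] + N∑_b Re s_b`) give, with `WF.formRe_eq_formRe_zero_add_potRe`,
`𝓔[aψ] + 𝓔[a†ψ] = (‖p‖² + N‖v‖₁/L³)‖ψ‖² + 𝓔[ψ] + 2Re B_v(ψ, N̂ψ) + N Re E_ψ` exactly. (2) The near-minimiser bookkeeping of
`KLS.klsMomentForT`: `‖ψ‖² = 1`, `E₀ ≤ 𝓔[ψ] ≤ E₀ + δ`, the cross-term bound `|Re B_v(ψ, N̂ψ) − E₀ n_k| ≤ √δ√𝓔[N̂ψ]`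
(`WF.abs_formRe_sub_le`, `WF.innerRe_numOp`) with the a priori bound `𝓔[N̂ψ] ≤ K_b` (`WF.qform_modeAn_le`, `WF.qform_modeCr_le`)
and the slack `δ₀(η, K_b)` of `KLS.exists_slack` (`2√δ√K_b ≤ (1+η)(δ + 2√δ√K_b) ≤ η`). No open mathematics. References (shape
only; nothing is cited as a fact): H. Wagner, Z. Physik 195 (1966) 273, §2; T. Kennedy, E. H. Lieb, B. S. Shastry, J. Stat. Phys.
53 (1988) 1019, (12)–(14); LSSY2005 App. A (A.6)–(A.7).
-/

noncomputable section

open scoped BigOperators ENNReal ComplexConjugate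
open Filter MeasureTheory

namespace Summit.AtomisticToContinuum.BoseEinsteinCondensation.Cruxes.PeriodicIRBound.TwoSectorGdTransfer

open Literature.MathematicalPhysics.QuantumManyBody.BoseGas
open Summit.AtomisticToContinuum.BoseEinsteinCondensation.Cruxes.PeriodicIRBound.LinearPhFloorWagner.WF

namespace FsumLower

variable {n : ℕ} {L : ℝ}

/-- **The two-sided f-sum identity with the exchange term kept** (the identity behind `WF.wagnerFeynman_form_le`): for a
core `(n+2)`-body `Φ` of finite form, integrable `w` and a mode `k` (`p = 2πk/L`, `N̂ = a_k†a_k`),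
`𝓔_w[a_kΦ] + 𝓔_w[a_k†Φ] = (‖p‖² + (n+2)‖w‖₁/L³)‖Φ‖² + 𝓔_w[Φ] + 2 Re B_w(Φ, N̂Φ) + (n+2) Re E_Φ` (reals). [folklore] -/
theorem toReal_qform_modeAn_add_modeCr (hL : 0 < L) {w : ℝ → ℝ≥0∞} (hw : Measurable w)
    (hint : (∫⁻ x : Space, w ‖x‖) ≠ ⊤) (k : Fin 3 → ℤ) {Φ : Config (n + 2) → ℂ} (hΦ : IsCore L Φ)
    (hΦE : qform w L Φ ≠ ⊤) :
    (qform w L (modeAn L (planeWaveMode L k) Φ)).toReal + (qform w L (modeCr (planeWaveMode L k) Φ)).toReal =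
      (‖latticeVec (2 * Real.pi / L) k‖ ^ 2 + ((n : ℝ) + 2) * wL1 w / L ^ 3) * (normSq L Φ).toReal +
        (qform w L Φ).toReal +
        2 * formRe w L Φ (modeCr (planeWaveMode L k) (modeAn L (planeWaveMode L k) Φ)) +
        ((n : ℝ) + 2) * (exchCoef w L k Φ).re := by
  -- the functions
  set aΦ := modeAn L (planeWaveMode L k) Φ with haΦ
  set cΦ := modeCr (planeWaveMode L k) Φ with hcΦ
  set NΦ := modeCr (planeWaveMode L k) aΦ with hNΦ
  have haΦc : IsCore L aΦ := isCore_modeAn hL k hΦ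
  have hcΦc : IsCore L cΦ := isCore_modeCr hL k hΦ
  have hNΦc : IsCore L NΦ := isCore_modeCr hL k haΦc
  -- finiteness
  have hPΦ : potForm w L Φ ≠ ⊤ := ne_top_of_le_ne_top hΦE (potForm_le_qform' w L Φ)
  obtain ⟨hPa, hPc⟩ := potForm_modeAn_ne_top_and hL hw hint k hΦ hPΦ
  obtain ⟨_, hPN⟩ := potForm_modeAn_ne_top_and hL hw hint k haΦc hPa
  have hTa : (∫⁻ Y in cellN (n + 1) L, kineticDensity aΦ Y) ≠ ⊤ := by
    rw [lintegral_kineticDensity_eq haΦc.contDiff L]; exact ENNReal.ofReal_ne_top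
  have hTc : (∫⁻ Z in cellN (n + 3) L, kineticDensity cΦ Z) ≠ ⊤ := by
    rw [lintegral_kineticDensity_eq hcΦc.contDiff L]; exact ENNReal.ofReal_ne_top
  have hTΦ : (∫⁻ X in cellN (n + 2) L, kineticDensity Φ X) ≠ ⊤ := by
    rw [lintegral_kineticDensity_eq hΦ.contDiff L]; exact ENNReal.ofReal_ne_top
  have hK := kinCrossENN_ne_top hL k hΦ
  have hnΦ : normSq L Φ ≠ ⊤ := (lintegral_cellN_sq_lt_top L hΦ.contDiff.continuous).ne
  have hεn : eps L k * normSq L Φ ≠ ⊤ := ENNReal.mul_ne_top ENNReal.ofReal_ne_top hnΦ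
  -- (i) the kinetic identity in reals
  have hkin := kinetic_wagnerFeynman hL k hΦ
  have hkinR : (∫⁻ Y in cellN (n + 1) L, kineticDensity aΦ Y).toReal +
      (∫⁻ Z in cellN (n + 3) L, kineticDensity cΦ Z).toReal =
      ‖latticeVec (2 * Real.pi / L) k‖ ^ 2 * (normSq L Φ).toReal +
        (∫⁻ X in cellN (n + 2) L, kineticDensity Φ X).toReal + 2 * formRe 0 L Φ NΦ := by
    have h := congrArg ENNReal.toReal hkin
    rw [ENNReal.toReal_add hTa hTc, ENNReal.toReal_add (ENNReal.add_ne_top.2 ⟨hεn, hTΦ⟩)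
      (ENNReal.mul_ne_top ENNReal.ofNat_ne_top hK), ENNReal.toReal_add hεn hTΦ, ENNReal.toReal_mul,
      ENNReal.toReal_mul, toReal_eps, ENNReal.toReal_ofNat] at h
    rw [h, formRe_zero_numOp hL k hΦ]
  -- (ii) the potential identity (exchange kept) and the potential cross term
  have hpotC := potForm_modeCr hL hw hint k hΦ hPΦ
  have hpotN := potRe_numOp hL hw hint k hΦ hPΦ
  -- the polarised form splits
  have hform : formRe w L Φ NΦ = formRe 0 L Φ NΦ + potRe w L Φ NΦ :=
    formRe_eq_formRe_zero_add_potRe hw hΦ.contDiff hNΦc.contDiff hPΦ hPN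
  -- the three energies split
  have hqa : (qform w L aΦ).toReal =
      (∫⁻ Y in cellN (n + 1) L, kineticDensity aΦ Y).toReal + (potForm w L aΦ).toReal := by
    rw [qform_eq_lintegral_kineticDensity_add_potForm, ENNReal.toReal_add hTa hPa]
  have hqc : (qform w L cΦ).toReal =
      (∫⁻ Z in cellN (n + 3) L, kineticDensity cΦ Z).toReal + (potForm w L cΦ).toReal := by
    rw [qform_eq_lintegral_kineticDensity_add_potForm, ENNReal.toReal_add hTc hPc]
  have hqΦ : (qform w L Φ).toReal =
      (∫⁻ X in cellN (n + 2) L, kineticDensity Φ X).toReal + (potForm w L Φ).toReal := by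
    rw [qform_eq_lintegral_kineticDensity_add_potForm, ENNReal.toReal_add hTΦ hPΦ]
  -- assemble
  rw [hqa, hqc, hqΦ, hform, hpotC, hpotN]
  push_cast
  linear_combination hkinR

end FsumLower

/-- **Stub S11b of the line `two-sector-gd-transfer` (v11)**: the two-sided f-sum lower bound at near-minimisers with the
exchange term kept, `FsumLowerBound` (SOFT-LOCATION.md Step 2): see the module docstring for the chain. [folklore] -/
theorem stub_fsumLowerBound : FsumLowerBound := by
  intro v hv hint m L hL hE2 n _hn η hη
  have hw : Measurable v := hv.1
  -- notation
  set E₀ : ℝ≥0∞ := periodicGroundStateEnergy v (m + 2) L with hE₀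
  set e0 : ℝ := E₀.toReal with he0
  set V₁ : ℝ := (∫⁻ x : Space, v ‖x‖).toReal with hV₁
  have hV₁0 : 0 ≤ V₁ := ENNReal.toReal_nonneg
  set pv : Space := latticeVec (2 * Real.pi / L) n with hpv
  -- the a priori constant for `𝓔[a†aψ]`
  set cB : ℝ := ‖pv‖ ^ 2 + ((m : ℝ) + 1) * V₁ / L ^ 3 with hcB
  have hcB0 : 0 ≤ cB := by positivity
  set Kb : ℝ := ((m : ℝ) + 2) * (((m : ℝ) + 2) * (e0 + 1) + cB * ((m : ℝ) + 2)) with hKb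
  -- the slack `δ₀(η, Kb)` absorbing the polar error
  obtain ⟨δ₀, hδ₀, hδ₀1, hslack⟩ := KLS.exists_slack (Kb := Kb) hη
  refine ⟨ENNReal.ofReal δ₀, ENNReal.ofReal_pos.2 hδ₀, fun Ψ hΨ => ?_⟩
  -- ===== the per-state bound =====
  -- the state
  set ψ : Config (m + 2) → ℂ := Ψ.ψ with hψdef
  have hψc : IsCore L ψ := isCore_trialState Ψ
  have hψ1 : normSq L ψ = 1 := Ψ.norm_eq
  have hψE : qform v L ψ ≤ E₀ + ENNReal.ofReal δ₀ := hΨ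
  have hEδtop : E₀ + ENNReal.ofReal δ₀ ≠ ⊤ := ENNReal.add_ne_top.2 ⟨hE2, ENNReal.ofReal_ne_top⟩
  have hψEtop : qform v L ψ ≠ ⊤ := ne_top_of_le_ne_top hEδtop hψE
  set qΨ : ℝ := (qform v L ψ).toReal with hqΨ
  have hq : qΨ ≤ e0 + δ₀ := by
    have h := ENNReal.toReal_mono hEδtop hψE
    rwa [ENNReal.toReal_add hE2 ENNReal.ofReal_ne_top, ENNReal.toReal_ofReal hδ₀.le] at h
  have hq0 : e0 ≤ qΨ := ENNReal.toReal_mono hψEtop (periodicGroundStateEnergy_le v Ψ)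
  -- the excitation `aψ` and `a†aψ`
  set aΨ : Config (m + 1) → ℂ := modeAn L (planeWaveMode L n) ψ with haΨ
  set NΨ : Config (m + 2) → ℂ := modeCr (planeWaveMode L n) aΨ with hNΨ
  have haΨc : IsCore L aΨ := isCore_modeAn hL n hψc
  have hNΨc : IsCore L NΨ := isCore_modeCr hL n haΨc
  -- mass: `‖aψ‖² = n_k ≤ m + 2`
  set νE : ℝ≥0∞ := cellOccupation (m + 2) L (planeWaveMode L n) ψ with hνE
  have hnAE : normSq L aΨ = νE := normSq_modeAn hL n ψ
  have hνle : νE ≤ ((m + 2 : ℕ) : ℝ≥0∞) * normSq L ψ :=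
    cellOccupation_le_mul_normSq hL n hψc.contDiff.continuous
  rw [hψ1, mul_one] at hνle
  have hνtop : νE ≠ ⊤ := ne_top_of_le_ne_top (ENNReal.natCast_ne_top _) hνle
  set nA : ℝ := νE.toReal with hnA
  have hnAle : nA ≤ (m : ℝ) + 2 := by
    have h := ENNReal.toReal_mono (ENNReal.natCast_ne_top _) hνle
    rw [ENNReal.toReal_natCast] at h
    push_cast at h
    exact h
  have hnAtop : normSq L aΨ ≠ ⊤ := by rw [hnAE]; exact hνtop
  have hnAr : (normSq L aΨ).toReal = nA := by rw [hnAE]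
  -- a priori energy bounds for `aψ`, `a†aψ`
  have htr : ∀ j : ℕ, ((j : ℝ≥0∞) + 1).toReal = (j : ℝ) + 1 := fun j => by
    rw [ENNReal.toReal_add (ENNReal.natCast_ne_top j) ENNReal.one_ne_top, ENNReal.toReal_natCast, ENNReal.toReal_one]
  have haΨE := qform_modeAn_le hL hw n hψc
  have haΨEtop : qform v L aΨ ≠ ⊤ :=
    ne_top_of_le_ne_top (ENNReal.mul_ne_top (PooledFloat.natCast_add_one_ne_top _) hψEtop) haΨE
  have hNΨE := qform_modeCr_le hL hw hint n haΨc
  have hNΨEtop : qform v L NΨ ≠ ⊤ :=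
    ne_top_of_le_ne_top (ENNReal.mul_ne_top (PooledFloat.natCast_add_one_ne_top _) (ENNReal.add_ne_top.2
      ⟨haΨEtop, ENNReal.mul_ne_top ENNReal.ofReal_ne_top hnAtop⟩)) hNΨE
  set qA : ℝ := (qform v L aΨ).toReal with hqA
  set K : ℝ := (qform v L NΨ).toReal with hK
  have hqAr : qA ≤ ((m : ℝ) + 2) * qΨ := by
    have h := ENNReal.toReal_mono (ENNReal.mul_ne_top (PooledFloat.natCast_add_one_ne_top _) hψEtop) haΨE
    rw [ENNReal.toReal_mul, htr] at h
    push_cast at h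
    linarith
  have hKr : K ≤ ((m : ℝ) + 2) * (qA + cB * nA) := by
    have h := ENNReal.toReal_mono (ENNReal.mul_ne_top (PooledFloat.natCast_add_one_ne_top _)
      (ENNReal.add_ne_top.2 ⟨haΨEtop, ENNReal.mul_ne_top ENNReal.ofReal_ne_top hnAtop⟩)) hNΨE
    rw [ENNReal.toReal_mul, htr, ENNReal.toReal_add haΨEtop (ENNReal.mul_ne_top ENNReal.ofReal_ne_top hnAtop),
      ENNReal.toReal_mul, ENNReal.toReal_ofReal (by positivity), hnAr] at h
    push_cast at h
    have hc : ‖pv‖ ^ 2 + ((m : ℝ) + 1) * V₁ / L ^ 3 = cB := by rw [hcB]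
    rw [hc] at h
    linarith
  have hKle : K ≤ Kb := by
    have h1 : qA ≤ ((m : ℝ) + 2) * (e0 + 1) := by
      have hq1 : qΨ ≤ e0 + 1 := by linarith
      exact hqAr.trans (mul_le_mul_of_nonneg_left hq1 (by positivity))
    have h3 : cB * nA ≤ cB * ((m : ℝ) + 2) := mul_le_mul_of_nonneg_left hnAle hcB0
    calc K ≤ ((m : ℝ) + 2) * (qA + cB * nA) := hKr
      _ ≤ ((m : ℝ) + 2) * (((m : ℝ) + 2) * (e0 + 1) + cB * ((m : ℝ) + 2)) := by gcongr
      _ = Kb := by rw [hKb]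
  -- the two-sided f-sum identity (exchange kept) and the polar cross-term bound
  set qC : ℝ := (qform v L (modeCr (planeWaveMode L n) ψ)).toReal with hqC
  set B : ℝ := formRe v L ψ NΨ with hB
  have hWF : qA + qC = ‖pv‖ ^ 2 + ((m : ℝ) + 2) * wL1 v / L ^ 3 + qΨ + 2 * B +
      ((m : ℝ) + 2) * (exchCoef v L n ψ).re := by
    have h := FsumLower.toReal_qform_modeAn_add_modeCr hL hw hint n hψc hψEtop
    rw [hψ1, ENNReal.toReal_one, mul_one] at h
    exact h
  have hBabs : |B - e0 * nA| ≤ Real.sqrt δ₀ * Real.sqrt K := by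
    have hnear : (qform v L ψ).toReal ≤ E₀.toReal * (normSq L ψ).toReal + δ₀ := by
      rw [hψ1, ENNReal.toReal_one, mul_one]; exact hq
    have h := abs_formRe_sub_le hL hw hψc hNΨc hψEtop hNΨEtop hE2 hδ₀.le hnear
    have hi : innerRe L ψ NΨ = nA := innerRe_numOp hL n hψc
    rwa [hi] at h
  -- ===== the real arithmetic =====
  have hBlow : -(Real.sqrt δ₀ * Real.sqrt Kb) ≤ B - e0 * nA := by
    have h1 := (abs_le.mp hBabs).1
    have h2 : Real.sqrt δ₀ * Real.sqrt K ≤ Real.sqrt δ₀ * Real.sqrt Kb :=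
      mul_le_mul_of_nonneg_left (Real.sqrt_le_sqrt hKle) (Real.sqrt_nonneg _)
    linarith
  have h2s : 2 * (Real.sqrt δ₀ * Real.sqrt Kb) ≤ η := by
    have hs := hslack δ₀ hδ₀.le le_rfl
    have hx : 0 ≤ δ₀ + 2 * (Real.sqrt δ₀ * Real.sqrt Kb) := by positivity
    have hy : 0 ≤ η * (δ₀ + 2 * (Real.sqrt δ₀ * Real.sqrt Kb)) := mul_nonneg hη.le hx
    nlinarith [hs, hy, hδ₀.le]
  simp only
  linarith [hWF, hq0, hBlow, h2s]

end Summit.AtomisticToContinuum.BoseEinsteinCondensation.Cruxes.PeriodicIRBound.TwoSectorGdTransfer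

end
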